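import Summits.Langlands.Langlands.Theorems.SqrtFiveQuarticCoversCertS3H12

/-!
# Route `Langlands/SqrtFiveQuarticCovers`, certificate `CertS3H12` (sheet 4.7): the named model
# identification NF-K1 (`hNF`) WEAKENED — its two side conditions `u ≠ 0`, `t² + t − 1 ≠ 0` are
# consequences of the `j`-equations, proved here in the kernel

Cell `pub/lg-quartmod` (F-L1), engine seat eng-4 g3; sibling of typ-3's
`Theorems/SqrtFiveQuarticCoversCertS3H12.lean` (p667755 + p668984, UNTOUCHED and imported).  In the
named input `hNF` of `certS3H12_of_modelIdentification_of_caseTwoEmpty_smooth` the third disjunct reads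
`∃ u t w, u ≠ 0 ∧ c₄³u³ = 27(u+1)³(u−3)³Δ ∧ t²+t−1 ≠ 0 ∧ c₄³(t²+t−1)⁵ = 125(t+1)(2t+1)³(2t²−3t+3)³Δ ∧
(5+2r)w² = 8t²−12t+7`.  The two non-vanishing clauses are NOT extra information: with `Δ ≠ 0`
(an elliptic curve is not a cusp),
* `u = 0` in the `J₂`-equation gives `0 = 27·1·(−27)·Δ`, i.e. `Δ = 0`;
* `t² + t − 1 = 0` in the `J₇`-equation gives `(t+1)(2t+1)³(2t²−3t+3)³·Δ = 0`, but in characteristic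
  `0` none of `t + 1`, `2t + 1`, `2t² − 3t + 3` has a common root with `t² + t − 1`
  (`t = −1 ↦ −1`, `t = −1/2 ↦ −5/4`, and `2t²−3t+3 = 0 = t²+t−1 ⇒ 5t = 5 ⇒ t = 1 ↦ 1`).
So the model identification may be ASKED without them: `hNFw` below is `hNF` with exactly the two
conjuncts `u ≠ 0 ∧` and `t ^ 2 + t - 1 ≠ 0 ∧` deleted (every other character identical; `hDat'`
byte-identical to typ-3's), hence WEAKER, and `certS3H12_of_modelIdentificationWeak_of_caseTwoEmpty_smooth
(hNFw) (hDat') : CertS3H12` BY NAME.  Offered to the planner seat as the text «ModelIdentificationS3H12w»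
(a candidate replacement of the registered stub `ModelIdentificationS3H12`; registering is not this
seat's call).

HONEST STATUS: conditional bookkeeping exactly as the parent file — two named inputs (NF-K1 in the
weaker form; CASE 2 EMPTY on smooth points, certified finite datum with three cell lineages + certnum
RQ-028) ⟹ `CertS3H12`; closes nothing on the ledger by itself; «a certified finite datum is not a
modularity statement»; nothing here proves modularity of any elliptic curve.
References: as in the parent file ([Zywina2015] §1.2–1.3; Chen 1999 Thm. 3.2; [DeligneRapoport1973]
IV-3; [Box2022] §1.1).
-/

noncomputable section

set_option linter.dupNamespace false -- project-wide option; `Summit.Langlands.Langlands` is the mandated namespace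

open scoped Matrix NumberField Polynomial IntermediateField
open NumberField Polynomial
open Literature.NumberTheory.Automorphic Summit.Langlands.Langlands.Theses.SqrtFiveQuarticCovers

namespace Summit.Langlands.Langlands.Theorems.SqrtFiveQuarticCovers

/-! ### §1 The side conditions follow from the `j`-equations -/

/-- **`u ≠ 0` and `t² + t − 1 ≠ 0` are forced.**  In a field of characteristic `0`, if `Δ ≠ 0`,
`c³·u³ = 27(u+1)³(u−3)³·Δ` (the `J₂`-equation `j·u³ = 27(u+1)³(u−3)³`, `j = c³/Δ`) and
`c³·(t²+t−1)⁵ = 125(t+1)(2t+1)³(2t²−3t+3)³·Δ` (the `J₇`-equation), then `u ≠ 0` (else `−729Δ = 0`)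
and `t² + t − 1 ≠ 0` (else a factor of the `J₇`-numerator vanishes at a root of `t² + t − 1`, which
forces `−1 = 0`, `−5/4 = 0` or `1 = 0`).  Geometrically: `u = 0` and `t² + t − 1 = 0` are cusps of
`X(s3)`, `X(ns⁺5)`, where `j = ∞`. [folklore] -/
theorem nfK1_sideConditions_of_jEquations {K : Type*} [Field K] [CharZero K] {c Δ u t : K}
    (hΔ : Δ ≠ 0) (hJ2 : c ^ 3 * u ^ 3 = 27 * (u + 1) ^ 3 * (u - 3) ^ 3 * Δ)
    (hJ7 : c ^ 3 * (t ^ 2 + t - 1) ^ 5 =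
      125 * (t + 1) * (2 * t + 1) ^ 3 * (2 * t ^ 2 - 3 * t + 3) ^ 3 * Δ) :
    u ≠ 0 ∧ t ^ 2 + t - 1 ≠ 0 := by
  constructor
  · rintro rfl
    have h : (729 : K) * Δ = 0 := by linear_combination hJ2
    rcases mul_eq_zero.mp h with h | h
    · norm_num at h
    · exact hΔ h
  · intro hD
    have h : (125 : K) * ((t + 1) * (2 * t + 1) ^ 3 * (2 * t ^ 2 - 3 * t + 3) ^ 3) * Δ = 0 := by
      have := hJ7
      rw [hD] at this
      linear_combination -this
    rcases mul_eq_zero.mp h with h | h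
    · rcases mul_eq_zero.mp h with h | h
      · norm_num at h
      · rcases mul_eq_zero.mp h with h | h
        · rcases mul_eq_zero.mp h with h | h
          · -- `t = −1`
            have ht : t = -1 := by linear_combination h
            rw [ht] at hD; norm_num at hD
          · -- `2t + 1 = 0`
            have h' : 2 * t + 1 = 0 := (pow_eq_zero_iff three_ne_zero).mp h
            have ht : t = -1 / 2 := by linear_combination h' / 2
            rw [ht] at hD; norm_num at hD
        · -- `2t² − 3t + 3 = 0`
          have h' : 2 * t ^ 2 - 3 * t + 3 = 0 := (pow_eq_zero_iff three_ne_zero).mp h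
          have ht : t = 1 := by linear_combination (2 * hD - h') / 5
          rw [ht] at hD; norm_num at hD
    · exact hΔ h

/-! ### §2 `CertS3H12` from the WEAKER model identification -/

/-- **`CertS3H12` from NF-K1 WITHOUT its side conditions and CASE 2 EMPTY on smooth points.**
`hNFw` is the hypothesis `hNF` of `certS3H12_of_modelIdentification_of_caseTwoEmpty_smooth` (typ-3,
p668984) with exactly the conjuncts `u ≠ 0 ∧` and `t ^ 2 + t - 1 ≠ 0 ∧` removed from its third
disjunct — so it only says: a non-degenerate point comes with `u, t, w ∈ K` satisfying the two
division-free `j`-equations [Zywina2015 §1.2–1.3: `J₂`, `J₇`; Chen 1999 Thm. 3.2 / Deligne–Rapoport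
IV-3: moduli interpretation] and the cell's `H12`-conic `(5+2r)w² = 8t²−12t+7` (class DERIVED in the
cell, DERIVATION-H12-CONIC.md b9b2c12f033f5452).  `hDat'` is byte-identical to the parent's.  Proof:
`nfK1_sideConditions_of_jEquations` restores the two clauses (with `Δ(E ⊗ K) ≠ 0`), then the parent
theorem applies.  CONDITIONAL bookkeeping; a certified finite datum is not a modularity statement.
[cite: Zywina2015, §1.2–1.3 (arXiv:1508.07660)] -/
theorem certS3H12_of_modelIdentificationWeak_of_caseTwoEmpty_smooth
    (hNFw : ∀ (K : Type) [Field K] [NumberField K], NumberField.IsTotallyReal K → Module.finrank ℚ K = 4 → (∃ r : K, r ^ 2 = 5) →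
        ∀ E : WeierstrassCurve (NumberField.RingOfIntegers K), E.Δ ≠ 0 →
          (∃ ρ : Literature.NumberTheory.GaloisRepresentations.FramedGaloisRep K (ZMod 3) 2, (∃ e : (E.baseChange K).geomTorsion ((3 : ℕ) : ℤ) ≃+ (Fin 2 → ZMod 3), ∀ (σ : Field.absoluteGaloisGroup K) (P : (E.baseChange K).geomTorsion ((3 : ℕ) : ℤ)), e (σ • P) = ((ρ σ : GL (Fin 2) (ZMod 3)) : Matrix (Fin 2) (Fin 2) (ZMod 3)) *ᵥ (e P)) ∧ ((∀ σ : Field.absoluteGaloisGroup K, (ρ σ : GL (Fin 2) (ZMod 3)) ∈ Subgroup.closure ({(⟨!![1, 0; 0, 2], !![1, 0; 0, 2], by decide, by decide⟩ : GL (Fin 2) (ZMod 3)), (⟨!![0, 1; 1, 0], !![0, 1; 1, 0], by decide, by decide⟩ : GL (Fin 2) (ZMod 3))} : Set (GL (Fin 2) (ZMod 3)))))) →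
          (∃ ρ : Literature.NumberTheory.GaloisRepresentations.FramedGaloisRep K (ZMod 5) 2, (∃ e : (E.baseChange K).geomTorsion ((5 : ℕ) : ℤ) ≃+ (Fin 2 → ZMod 5), ∀ (σ : Field.absoluteGaloisGroup K) (P : (E.baseChange K).geomTorsion ((5 : ℕ) : ℤ)), e (σ • P) = ((ρ σ : GL (Fin 2) (ZMod 5)) : Matrix (Fin 2) (Fin 2) (ZMod 5)) *ᵥ (e P)) ∧ ((∀ σ : Field.absoluteGaloisGroup K, (ρ σ : GL (Fin 2) (ZMod 5)) ∈ Subgroup.closure ({(⟨!![3, 1; 3, 3], !![3, 4; 2, 3], by decide, by decide⟩ : GL (Fin 2) (ZMod 5)), (⟨!![1, 0; 0, 4], !![1, 0; 0, 4], by decide, by decide⟩ : GL (Fin 2) (ZMod 5))} : Set (GL (Fin 2) (ZMod 5)))))) →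
          ∀ r : K, r ^ 2 = 5 →
            (E.baseChange K).c₄ = 0 ∨
            (E.baseChange K).c₄ ^ 3 = 8000 * (E.baseChange K).Δ ∨
            ∃ u t w : K,
              (E.baseChange K).c₄ ^ 3 * u ^ 3 = 27 * (u + 1) ^ 3 * (u - 3) ^ 3 * (E.baseChange K).Δ ∧
              (E.baseChange K).c₄ ^ 3 * (t ^ 2 + t - 1) ^ 5 =
                125 * (t + 1) * (2 * t + 1) ^ 3 * (2 * t ^ 2 - 3 * t + 3) ^ 3 * (E.baseChange K).Δ ∧
              (5 + 2 * r) * w ^ 2 = 8 * t ^ 2 - 12 * t + 7)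
    (hDat' : ∀ (K : Type) [Field K] [NumberField K], NumberField.IsTotallyReal K → Module.finrank ℚ K = 4 →
        ∀ r : K, r ^ 2 = 5 →
          ∀ t n v w : K,
            n ^ 3 = t ^ 3 + 2 * t ^ 2 - 1 →
            v ^ 2 = (5 * (2 * t + 1) * (2 * t ^ 2 - 3 * t + 3) * n) ^ 2
                + 12 * (5 * (2 * t + 1) * (2 * t ^ 2 - 3 * t + 3) * n) * (t ^ 2 + t - 1) ^ 2
                + 144 * (t ^ 2 + t - 1) ^ 4 →
            (5 + 2 * r) * w ^ 2 = 8 * t ^ 2 - 12 * t + 7 →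
            v ≠ 0 → w ≠ 0 →
            (∃ a b : ℚ, t = (a : K) + (b : K) * r) ∧ (∃ a b : ℚ, n = (a : K) + (b : K) * r)) :
    CertS3H12 := by
  refine certS3H12_of_modelIdentification_of_caseTwoEmpty_smooth ?_ hDat'
  intro K _ _ hK hd hr5 E hΔ h3 h5 r hr
  rcases hNFw K hK hd hr5 E hΔ h3 h5 r hr with h0 | h8000 | ⟨u, t, w, hJ2, hJ7, hW⟩
  · exact Or.inl h0
  · exact Or.inr (Or.inl h8000)
  · have hΔK : (E.baseChange K).Δ ≠ 0 := by
      rw [WeierstrassCurve.baseChange, WeierstrassCurve.map_Δ]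
      exact (map_ne_zero_iff _ (FaithfulSMul.algebraMap_injective (𝓞 K) K)).2 hΔ
    obtain ⟨hu, hDt⟩ := nfK1_sideConditions_of_jEquations hΔK hJ2 hJ7
    exact Or.inr (Or.inr ⟨u, t, w, hu, hJ2, hDt, hJ7, hW⟩)

end Summit.Langlands.Langlands.Theorems.SqrtFiveQuarticCovers

end
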